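import Mathlib
import HarnessLib
import Literature.Dynamics.Hyperbolic.RGFlowStableManifoldLipschitz
import Literature.Dynamics.Hyperbolic.RGFlowStableManifoldReduced

/-!
# The fine-tuning theorem with norm-bound predicates, II: Lipschitz dependence on the data and
# the second fixed point ([ABKM19] Thm 12.1 (continuity part) and Lemma 12.6, reduced form)

Continuation of `RGFlowStableManifoldReduced.lean` (irrelevant coordinates measured by predicates
`Q k y c`, relevant trajectory as the only unknown).  As in `RGFlowStableManifoldLipschitz.lean`
(the Banach-space version) the contraction estimate is run on the DIFFERENCE of the tuned
trajectories of two nearby systems `(A, B, S, y₀)`, `(A', B', S', y₀')` measured with the SAME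
predicates `Q` (in [ABKM19] the norms do not depend on the tuning parameter `q`: the weights of
Theorem 7.1 are built from the `q = 0` decomposition): if `D` bounds the weighted distance then so
does `κD + Δ` with `Δ = pertSize α β η ε a b l m` linear in the perturbation, hence the distance
is `≤ Δ/(1−κ)`; and if the system depends on a parameter `h ∈ E_0` in a Lipschitz way with small
constants, `h ↦ x_0(h)` is a `½`-contraction of a ball of the complete space `E_0` and has a fixed
point `x_0(h⋆) = h⋆` — Lemma 12.6, the second fixed point `Π_{H_0} Ẑ(𝒦, ℋ(𝒦)) = ℋ(𝒦)`.

* `RGFlow.IsSubaddNormBound Q` — `IsNormBound` plus subadditivity and symmetry of the predicates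
  (`‖y + y'‖ ≤ ‖y‖ + ‖y'‖`, `‖−y‖ = ‖y‖`);
* `RGFlow.IsTunedQ`, `RGFlow.InTubeQ` — tuned relevant trajectories and the tube, predicate form;
* `RGFlow.distQ_step`, `RGFlow.distQ_iterate`, **`RGFlow.norm_sub_le_of_isTunedQ`** — the
  relevant coordinates of two tuned trajectories of nearby systems are within `η^k Δ/(1−κ)`;
* **`RGFlow.exists_isTunedQ_initial_eq`** — Lemma 12.6 in predicate form.

Everything is proved; no named fact.

## References
* S. Adams, S. Buchholz, R. Kotecký, S. Müller, arXiv:1910.13564, Ch. 12: Theorem 12.1,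
  (12.43)–(12.49), Lemma 12.6 with its proof (12.50)–(12.56) [AdamsBuchholzKoteckyMuller2019].
* D. C. Brydges, IAS/Park City Math. Ser. 16 (2009), §2.10, Theorem 2.16 [Brydges2009].
-/

noncomputable section

open Set Function Metric Filter
open scoped NNReal Topology

namespace Literature.Dynamics.Hyperbolic

namespace RGFlow

variable {E : ℕ → Type*} [∀ k, NormedAddCommGroup (E k)] [∀ k, NormedSpace ℝ (E k)]
  {F : ℕ → Type*} [∀ k, AddCommGroup (F k)]

/-! ## §5 Subadditive norm-bound predicates, tuned trajectories, tubes -/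

/-- Norm-bound predicates with the triangle inequality and symmetry: `Q k y c ∧ Q k y' c' →
Q k (y + y') (c + c')` and `Q k y c → Q k (−y) c` (for the tree's `WeakNormLE`: `WeakNormLE.add`
and `tayNorm_smul` with `−1`). [cite: AdamsBuchholzKoteckyMuller2019, Ch. 12, eq. (12.2)] -/
structure IsSubaddNormBound (Q : ∀ k, F k → ℝ → Prop) : Prop extends IsNormBound Q where
  /-- triangle inequality -/
  add : ∀ k (y y' : F k) (c c' : ℝ), Q k y c → Q k y' c' → Q k (y + y') (c + c')
  /-- symmetry -/
  neg : ∀ k (y : F k) (c : ℝ), Q k y c → Q k (-y) c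

omit [∀ k, NormedAddCommGroup (E k)] [∀ k, NormedSpace ℝ (E k)] in
/-- `‖y − y'‖ ≤ ‖y‖ + ‖y'‖` for subadditive symmetric predicates.
[cite: AdamsBuchholzKoteckyMuller2019, Ch. 12, eq. (12.2)] -/
theorem IsSubaddNormBound.sub {Q : ∀ k, F k → ℝ → Prop} (hQ : IsSubaddNormBound Q) (k : ℕ)
    (y y' : F k) (c c' : ℝ) (h : Q k y c) (h' : Q k y' c') : Q k (y - y') (c + c') := by
  rw [sub_eq_add_neg]; exact hQ.add k y (-y') c c' h (hQ.neg k y' c' h')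

/-- `x` is a TUNED relevant trajectory of `(A, B, S, y₀)`: `x_N = 0` and
`x_{k+1} = A_k x_k + B_k y_k` with `y = fwd S y₀ x` ([ABKM19] (12.9)).
[cite: AdamsBuchholzKoteckyMuller2019, Ch. 12, eq. (12.9)] -/
structure IsTunedQ (N : ℕ) (A : ∀ k, E k ≃L[ℝ] E (k + 1)) (B : ∀ k, F k →+ E (k + 1))
    (S : ∀ k, E k → F k → F (k + 1)) (y₀ : F 0) (x : ∀ k, E k) : Prop where
  /-- the tuning condition -/
  final : x N = 0
  /-- the relevant recursion -/
  rel : ∀ k, k < N → x (k + 1) = A k (x k) + B k (fwd S y₀ x k)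

/-- The `ε`-tube with rate `η`, predicate form: `‖x_k‖ ≤ ε η^k` and `‖y_k‖_k ≤ ε η^k` for `k ≤ N`.
[cite: AdamsBuchholzKoteckyMuller2019, Ch. 12, eq. (12.2)] -/
def InTubeQ (N : ℕ) (η ε : ℝ) (Q : ∀ k, F k → ℝ → Prop) (S : ∀ k, E k → F k → F (k + 1))
    (y₀ : F 0) (x : ∀ k, E k) : Prop :=
  ∀ k, k ≤ N → ‖x k‖ ≤ ε * η ^ k ∧ Q k (fwd S y₀ x k) (ε * η ^ k)

/-! ## §6 The contraction estimate for the difference of two tuned trajectories -/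

section comparison

variable {N : ℕ} {r α β σ η κ ε a b l m : ℝ} {Q : ∀ k, F k → ℝ → Prop}
  {A A' : ∀ k, E k ≃L[ℝ] E (k + 1)} {B B' : ∀ k, F k →+ E (k + 1)}
  {S S' : ∀ k, E k → F k → F (k + 1)} {y₀ y₀' : F 0} {x x' : ∀ k, E k}

/-- **One contraction step for the difference of two tuned trajectories** (predicate form of
`RGFlow.dist_step`): if `D ≥ 0` bounds the weighted distance — `‖x_k − x'_k‖ ≤ Dη^k` and
`‖y_k − y'_k‖_k ≤ Dη^k` — then so does `κD + Δ`, `Δ = pertSize α β η ε a b l m`, where `a, b, l, m`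
bound `A⁻¹ − A'⁻¹`, `B − B'`, `S − S'` and `y₀ − y₀'`.
[cite: AdamsBuchholzKoteckyMuller2019, Ch. 12, eqs. (12.43)–(12.46)] -/
theorem distQ_step (hQ : IsSubaddNormBound Q) (hT : IsRGStepQ N r α β σ Q A B S) (hη : 0 < η)
    (hη1 : η ≤ 1) (hα : 0 ≤ α) (hβ : 0 ≤ β) (hκ₁ : α * (η + β) ≤ κ)
    (hκ₂ : σ ≤ κ * η) (hε : 0 ≤ ε) (hεr : ε ≤ r)
    (htr : IsTunedQ N A B S y₀ x) (htr' : IsTunedQ N A' B' S' y₀' x')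
    (htu : InTubeQ N η ε Q S y₀ x) (htu' : InTubeQ N η ε Q S' y₀' x')
    (ha0 : 0 ≤ a) (hl0 : 0 ≤ l)
    (ha : ∀ k, k < N → ∀ w : E (k + 1), ‖(A k).symm w - (A' k).symm w‖ ≤ a * ‖w‖)
    (hb : ∀ k, k < N → ∀ (v : F k) (c : ℝ), Q k v c → ‖B k v - B' k v‖ ≤ b * c)
    (hl : ∀ k, k < N → ∀ (u : E k) (v : F k) (c : ℝ), ‖u‖ ≤ r → Q k v c → c ≤ r →
      Q (k + 1) (S k u v - S' k u v) (l * max ‖u‖ c))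
    (hm : Q 0 (y₀ - y₀') m) {D : ℝ} (hD0 : 0 ≤ D)
    (hD : ∀ k, k ≤ N → ‖x k - x' k‖ ≤ D * η ^ k ∧
      Q k (fwd S y₀ x k - fwd S' y₀' x' k) (D * η ^ k)) :
    ∀ k, k ≤ N → ‖x k - x' k‖ ≤ (κ * D + pertSize α β η ε a b l m) * η ^ k ∧
      Q k (fwd S y₀ x k - fwd S' y₀' x' k) ((κ * D + pertSize α β η ε a b l m) * η ^ k) := by
  set Δ := pertSize α β η ε a b l m with hΔ
  have hκ0 : 0 ≤ κ := le_trans (mul_nonneg hα (add_nonneg hη.le hβ)) hκ₁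
  have hΔl : l * ε / η ≤ Δ := (le_max_left _ _).trans (le_max_right _ _)
  have hΔab : (α * b + a * (η + β + b)) * ε ≤ Δ := (le_max_right _ _).trans (le_max_right _ _)
  have hΔm : m ≤ Δ := le_max_left _ _
  have hΔ0 : 0 ≤ Δ := by
    have : 0 ≤ l * ε / η := div_nonneg (mul_nonneg hl0 hε) hη.le
    exact this.trans hΔl
  have hηk : ∀ k : ℕ, 0 ≤ η ^ k := fun k => pow_nonneg hη.le k
  have hηk1 : ∀ k : ℕ, η ^ k ≤ 1 := fun k => pow_le_one₀ hη.le hη1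
  have hball : ∀ (t : ℝ) (k : ℕ), t ≤ ε * η ^ k → t ≤ r :=
    fun t k ht => ht.trans ((mul_le_of_le_one_right hε (hηk1 k)).trans hεr)
  intro k hk
  constructor
  · -- relevant component, solved backwards
    rcases Nat.lt_or_ge k N with hkN | hkN
    · have hk1 : k + 1 ≤ N := hkN
      set yk := fwd S y₀ x k with hyk
      set yk' := fwd S' y₀' x' k with hyk'
      have hxk : x k = (A k).symm (x (k + 1) - B k yk) := by
        rw [htr.rel k hkN, add_sub_cancel_right, ContinuousLinearEquiv.symm_apply_apply]
      have hxk' : x' k = (A' k).symm (x' (k + 1) - B' k yk') := by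
        rw [htr'.rel k hkN, add_sub_cancel_right, ContinuousLinearEquiv.symm_apply_apply]
      have hsplit : x k - x' k =
          (A k).symm ((x (k + 1) - x' (k + 1)) - (B k (yk - yk') + (B k yk' - B' k yk')))
            + ((A k).symm (x' (k + 1) - B' k yk') - (A' k).symm (x' (k + 1) - B' k yk')) := by
        have hPQ : (x (k + 1) - x' (k + 1)) - (B k (yk - yk') + (B k yk' - B' k yk')) =
            (x (k + 1) - B k yk) - (x' (k + 1) - B' k yk') := by
          rw [map_sub]; abel
        rw [hPQ, map_sub (A k).symm (x (k + 1) - B k yk) (x' (k + 1) - B' k yk'), ← hxk, ← hxk']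
        abel
      have h1 : ‖x (k + 1) - x' (k + 1)‖ ≤ D * η ^ (k + 1) := (hD (k + 1) hk1).1
      have h2 : ‖B k (yk - yk')‖ ≤ β * (D * η ^ k) := hT.norm_B_le k hkN _ _ (hD k hk).2
      have h3 : ‖B k yk' - B' k yk'‖ ≤ b * (ε * η ^ k) := hb k hkN _ _ (htu' k hk).2
      have h4 : ‖x' (k + 1) - B' k yk'‖ ≤ ε * η ^ (k + 1) + (β + b) * (ε * η ^ k) := by
        refine (norm_sub_le _ _).trans (add_le_add (htu' (k + 1) hk1).1 ?_)
        have : B' k yk' = B k yk' - (B k yk' - B' k yk') := by abel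
        rw [this]
        refine (norm_sub_le _ _).trans ?_
        calc ‖B k yk'‖ + ‖B k yk' - B' k yk'‖
            ≤ β * (ε * η ^ k) + b * (ε * η ^ k) :=
              add_le_add (hT.norm_B_le k hkN _ _ (htu' k hk).2) h3
          _ = (β + b) * (ε * η ^ k) := by ring
      rw [hsplit]
      refine (norm_add_le _ _).trans ?_
      have hfirst : ‖(A k).symm ((x (k + 1) - x' (k + 1)) - (B k (yk - yk') + (B k yk' - B' k yk')))‖
          ≤ α * (D * η ^ (k + 1) + (β * (D * η ^ k) + b * (ε * η ^ k))) := by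
        refine (hT.norm_symm_le k hkN _).trans (mul_le_mul_of_nonneg_left ?_ hα)
        exact (norm_sub_le _ _).trans (add_le_add h1 ((norm_add_le _ _).trans (add_le_add h2 h3)))
      have hsecond : ‖(A k).symm (x' (k + 1) - B' k yk') - (A' k).symm (x' (k + 1) - B' k yk')‖
          ≤ a * (ε * η ^ (k + 1) + (β + b) * (ε * η ^ k)) :=
        (ha k hkN _).trans (mul_le_mul_of_nonneg_left h4 ha0)
      refine (add_le_add hfirst hsecond).trans ?_
      rw [pow_succ η k]
      have hgoal : α * (D * (η ^ k * η) + (β * (D * η ^ k) + b * (ε * η ^ k))) +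
          a * (ε * (η ^ k * η) + (β + b) * (ε * η ^ k))
          = (α * (η + β) * D + (α * b + a * (η + β + b)) * ε) * η ^ k := by ring
      rw [hgoal]
      exact mul_le_mul_of_nonneg_right (add_le_add (mul_le_mul_of_nonneg_right hκ₁ hD0) hΔab) (hηk k)
    · obtain rfl : k = N := le_antisymm hk hkN
      rw [htr.final, htr'.final, sub_zero, norm_zero]
      exact mul_nonneg (add_nonneg (mul_nonneg hκ0 hD0) hΔ0) (hηk _)
  · -- irrelevant component, forwards
    rcases Nat.eq_zero_or_eq_succ_pred k with hk0 | hks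
    · subst hk0
      rw [fwd_zero, fwd_zero, pow_zero, mul_one]
      exact hQ.mono _ _ _ _ hm (hΔm.trans (le_add_of_nonneg_left (mul_nonneg hκ0 hD0)))
    · set j := k.pred with hj
      rw [hks] at hk ⊢
      have hjN : j < N := Nat.lt_of_succ_le hk
      have hjle : j ≤ N := hjN.le
      rw [fwd_succ, fwd_succ]
      have hsplit : S j (x j) (fwd S y₀ x j) - S' j (x' j) (fwd S' y₀' x' j) =
          (S j (x j) (fwd S y₀ x j) - S j (x' j) (fwd S' y₀' x' j)) +
            (S j (x' j) (fwd S' y₀' x' j) - S' j (x' j) (fwd S' y₀' x' j)) := by abel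
      rw [hsplit]
      have h1 : Q (j + 1) (S j (x j) (fwd S y₀ x j) - S j (x' j) (fwd S' y₀' x' j))
          (σ * max ‖x j - x' j‖ (D * η ^ j)) :=
        hT.lipschitz j hjN _ _ _ _ _ _ _ (hball _ j (htu j hjle).1) (hball _ j (htu' j hjle).1)
          (htu j hjle).2 (hball _ j le_rfl) (htu' j hjle).2 (hball _ j le_rfl) (hD j hjle).2
      have h2 : Q (j + 1) (S j (x' j) (fwd S' y₀' x' j) - S' j (x' j) (fwd S' y₀' x' j))
          (l * max ‖x' j‖ (ε * η ^ j)) :=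
        hl j hjN _ _ _ (hball _ j (htu' j hjle).1) (htu' j hjle).2 (hball _ j le_rfl)
      refine hQ.mono _ _ _ _ (hQ.add _ _ _ _ _ h1 h2) ?_
      have hm1 : max ‖x j - x' j‖ (D * η ^ j) = D * η ^ j := max_eq_right (hD j hjle).1
      have hm2 : max ‖x' j‖ (ε * η ^ j) = ε * η ^ j := max_eq_right (htu' j hjle).1
      rw [hm1, hm2, pow_succ]
      have hσ' : σ * (D * η ^ j) ≤ κ * D * (η ^ j * η) := by
        have := mul_le_mul_of_nonneg_right hκ₂ (mul_nonneg hD0 (hηk j))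
        calc σ * (D * η ^ j) ≤ κ * η * (D * η ^ j) := this
          _ = κ * D * (η ^ j * η) := by ring
      have hl' : l * (ε * η ^ j) ≤ Δ * (η ^ j * η) := by
        have h := mul_le_mul_of_nonneg_right hΔl (mul_nonneg (hηk j) hη.le)
        calc l * (ε * η ^ j) = l * ε / η * (η ^ j * η) := by field_simp
          _ ≤ Δ * (η ^ j * η) := h
      calc σ * (D * η ^ j) + l * (ε * η ^ j) ≤ κ * D * (η ^ j * η) + Δ * (η ^ j * η) :=
            add_le_add hσ' hl'
        _ = (κ * D + Δ) * (η ^ j * η) := by ring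

/-- Iteration of `distQ_step`: after `n` steps the weighted distance is at most
`κ^n · 2ε + Δ/(1−κ)`. [cite: AdamsBuchholzKoteckyMuller2019, Ch. 12, eqs. (12.43)–(12.46)] -/
theorem distQ_iterate (hQ : IsSubaddNormBound Q) (hT : IsRGStepQ N r α β σ Q A B S) (hη : 0 < η)
    (hη1 : η ≤ 1) (hα : 0 ≤ α) (hβ : 0 ≤ β) (hκ₁ : α * (η + β) ≤ κ)
    (hκ₂ : σ ≤ κ * η) (hκ : κ < 1) (hε : 0 ≤ ε) (hεr : ε ≤ r)
    (htr : IsTunedQ N A B S y₀ x) (htr' : IsTunedQ N A' B' S' y₀' x')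
    (htu : InTubeQ N η ε Q S y₀ x) (htu' : InTubeQ N η ε Q S' y₀' x')
    (ha0 : 0 ≤ a) (hl0 : 0 ≤ l)
    (ha : ∀ k, k < N → ∀ w : E (k + 1), ‖(A k).symm w - (A' k).symm w‖ ≤ a * ‖w‖)
    (hb : ∀ k, k < N → ∀ (v : F k) (c : ℝ), Q k v c → ‖B k v - B' k v‖ ≤ b * c)
    (hl : ∀ k, k < N → ∀ (u : E k) (v : F k) (c : ℝ), ‖u‖ ≤ r → Q k v c → c ≤ r →
      Q (k + 1) (S k u v - S' k u v) (l * max ‖u‖ c))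
    (hm : Q 0 (y₀ - y₀') m) (n : ℕ) :
    ∀ k, k ≤ N →
      ‖x k - x' k‖ ≤ (κ ^ n * (2 * ε) + pertSize α β η ε a b l m / (1 - κ)) * η ^ k ∧
      Q k (fwd S y₀ x k - fwd S' y₀' x' k)
        ((κ ^ n * (2 * ε) + pertSize α β η ε a b l m / (1 - κ)) * η ^ k) := by
  set Δ := pertSize α β η ε a b l m with hΔ
  have hκ0 : 0 ≤ κ := le_trans (mul_nonneg hα (add_nonneg hη.le hβ)) hκ₁
  have hΔ0 : 0 ≤ Δ := by
    have : 0 ≤ l * ε / η := div_nonneg (mul_nonneg hl0 hε) hη.le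
    exact this.trans ((le_max_left _ _).trans (le_max_right _ _))
  have hΔ1 : 0 ≤ Δ / (1 - κ) := div_nonneg hΔ0 (by linarith)
  induction n with
  | zero =>
      intro k hk
      have hηk : 0 ≤ η ^ k := pow_nonneg hη.le k
      have hb2 : ‖x k - x' k‖ ≤ 2 * ε * η ^ k ∧
          Q k (fwd S y₀ x k - fwd S' y₀' x' k) (2 * ε * η ^ k) := by
        constructor
        · calc ‖x k - x' k‖ ≤ ‖x k‖ + ‖x' k‖ := norm_sub_le _ _
            _ ≤ ε * η ^ k + ε * η ^ k := add_le_add (htu k hk).1 (htu' k hk).1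
            _ = 2 * ε * η ^ k := by ring
        · have := hQ.sub k _ _ _ _ (htu k hk).2 (htu' k hk).2
          rw [show ε * η ^ k + ε * η ^ k = 2 * ε * η ^ k by ring] at this
          exact this
      rw [pow_zero, one_mul]
      exact ⟨hb2.1.trans (mul_le_mul_of_nonneg_right (le_add_of_nonneg_right hΔ1) hηk),
        hQ.mono _ _ _ _ hb2.2 (mul_le_mul_of_nonneg_right (le_add_of_nonneg_right hΔ1) hηk)⟩
  | succ n ih =>
      have hDn0 : 0 ≤ κ ^ n * (2 * ε) + Δ / (1 - κ) :=
        add_nonneg (mul_nonneg (pow_nonneg hκ0 n) (by linarith)) hΔ1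
      have hstep := distQ_step hQ hT hη hη1 hα hβ hκ₁ hκ₂ hε hεr htr htr' htu htu' ha0 hl0
        ha hb hl hm hDn0 ih
      have hid : κ * (κ ^ n * (2 * ε) + Δ / (1 - κ)) + Δ = κ ^ (n + 1) * (2 * ε) + Δ / (1 - κ) := by
        have h1 : (1 - κ) ≠ 0 := by linarith
        field_simp
        ring
      intro k hk
      have h := hstep k hk
      rw [hid] at h
      exact h

/-- **Lipschitz dependence of the tuned relevant trajectory on the data** ([ABKM19] Thm 12.1,
continuity content, predicate form): `‖x_k − x'_k‖ ≤ η^k Δ/(1−κ)` for `k ≤ N`.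
[cite: AdamsBuchholzKoteckyMuller2019, Thm 12.1] -/
theorem norm_sub_le_of_isTunedQ (hQ : IsSubaddNormBound Q) (hT : IsRGStepQ N r α β σ Q A B S)
    (hη : 0 < η) (hη1 : η ≤ 1) (hα : 0 ≤ α) (hβ : 0 ≤ β) (hκ₁ : α * (η + β) ≤ κ)
    (hκ₂ : σ ≤ κ * η) (hκ : κ < 1) (hε : 0 ≤ ε) (hεr : ε ≤ r)
    (htr : IsTunedQ N A B S y₀ x) (htr' : IsTunedQ N A' B' S' y₀' x')
    (htu : InTubeQ N η ε Q S y₀ x) (htu' : InTubeQ N η ε Q S' y₀' x')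
    (ha0 : 0 ≤ a) (hl0 : 0 ≤ l)
    (ha : ∀ k, k < N → ∀ w : E (k + 1), ‖(A k).symm w - (A' k).symm w‖ ≤ a * ‖w‖)
    (hb : ∀ k, k < N → ∀ (v : F k) (c : ℝ), Q k v c → ‖B k v - B' k v‖ ≤ b * c)
    (hl : ∀ k, k < N → ∀ (u : E k) (v : F k) (c : ℝ), ‖u‖ ≤ r → Q k v c → c ≤ r →
      Q (k + 1) (S k u v - S' k u v) (l * max ‖u‖ c))
    (hm : Q 0 (y₀ - y₀') m) :
    ∀ k, k ≤ N → ‖x k - x' k‖ ≤ pertSize α β η ε a b l m / (1 - κ) * η ^ k := by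
  set Δ := pertSize α β η ε a b l m with hΔ
  have hκ0 : 0 ≤ κ := le_trans (mul_nonneg hα (add_nonneg hη.le hβ)) hκ₁
  intro k hk
  have hlim : Tendsto (fun n : ℕ => (κ ^ n * (2 * ε) + Δ / (1 - κ)) * η ^ k) atTop
      (𝓝 ((0 * (2 * ε) + Δ / (1 - κ)) * η ^ k)) :=
    (((tendsto_pow_atTop_nhds_zero_of_lt_one hκ0 hκ).mul_const _).add_const _).mul_const _
  rw [zero_mul, zero_add] at hlim
  exact ge_of_tendsto' hlim fun n => (distQ_iterate hQ hT hη hη1 hα hβ hκ₁ hκ₂ hκ hε hεr htr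
    htr' htu htu' ha0 hl0 ha hb hl hm n k hk).1

end comparison

/-! ## §7 The second fixed point ([ABKM19] Lemma 12.6), predicate form -/

section secondFixedPoint

variable [∀ k, CompleteSpace (E k)]
  {N : ℕ} {r α β σ η κ ε ρ c₀ a₀ b₀ l₀ m₀ : ℝ} {Q : ∀ k, F k → ℝ → Prop}
  {A : E 0 → ∀ k, E k ≃L[ℝ] E (k + 1)} {B : E 0 → ∀ k, F k →+ E (k + 1)}
  {S : E 0 → ∀ k, E k → F k → F (k + 1)} {y₀ : E 0 → F 0}

/-- **The second fixed point** ([ABKM19] Lemma 12.6) with norm-bound predicates.  Let the system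
depend on a parameter `h ∈ E_0`, `‖h‖ ≤ ρ`: every `(A^h, B^h, S^h)` satisfies `IsRGStepQ N r α β σ Q`,
the data obey `‖y₀^h‖_0 ≤ c₀ ≤ ε`, and the dependence on `h` is Lipschitz —
`‖(A^h_k)⁻¹ − (A^{h'}_k)⁻¹‖ ≤ a₀‖h−h'‖`, `‖(B^h_k − B^{h'}_k) y‖ ≤ b₀‖h−h'‖ ‖y‖_k`,
`‖(S^h_k − S^{h'}_k)(u,v)‖_{k+1} ≤ l₀‖h−h'‖ max(‖u‖, ‖v‖_k)` on the `r`-ball,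
`‖y₀^h − y₀^{h'}‖_0 ≤ m₀‖h−h'‖` — with `max(m₀, l₀ε/η, (αb₀ + a₀(η+β+2ρb₀))ε) ≤ (1−κ)/2` and `ε ≤ ρ`.
Then there is `h⋆`, `‖h⋆‖ ≤ ρ`, and a tuned relevant trajectory `x` of system `h⋆` in the
`ε`-tube with `x_0 = h⋆` ([ABKM19] (12.50): `Π_{H_0} Ẑ(𝒦, ℋ(𝒦)) = ℋ(𝒦)`).
[cite: AdamsBuchholzKoteckyMuller2019, Lemma 12.6] -/
theorem exists_isTunedQ_initial_eq (hQ : IsSubaddNormBound Q) (hη : 0 < η) (hη1 : η ≤ 1)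
    (hα : 0 ≤ α) (hβ : 0 ≤ β) (hκ₁ : α * (η + β) ≤ κ) (hκ₂ : σ ≤ κ * η)
    (hκ : κ < 1) (hε : 0 ≤ ε) (hεr : ε ≤ r) (hερ : ε ≤ ρ) (ha0 : 0 ≤ a₀) (hb0 : 0 ≤ b₀)
    (hl0 : 0 ≤ l₀) (hc₀ : c₀ ≤ ε)
    (hT : ∀ h : E 0, ‖h‖ ≤ ρ → IsRGStepQ N r α β σ Q (A h) (B h) (S h))
    (hy₀ : ∀ h : E 0, ‖h‖ ≤ ρ → Q 0 (y₀ h) c₀)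
    (ha : ∀ h h' : E 0, ‖h‖ ≤ ρ → ‖h'‖ ≤ ρ → ∀ k, k < N → ∀ w : E (k + 1),
      ‖(A h k).symm w - (A h' k).symm w‖ ≤ a₀ * ‖h - h'‖ * ‖w‖)
    (hb : ∀ h h' : E 0, ‖h‖ ≤ ρ → ‖h'‖ ≤ ρ → ∀ k, k < N → ∀ (v : F k) (c : ℝ), Q k v c →
      ‖B h k v - B h' k v‖ ≤ b₀ * ‖h - h'‖ * c)
    (hl : ∀ h h' : E 0, ‖h‖ ≤ ρ → ‖h'‖ ≤ ρ → ∀ k, k < N → ∀ (u : E k) (v : F k) (c : ℝ),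
      ‖u‖ ≤ r → Q k v c → c ≤ r → Q (k + 1) (S h k u v - S h' k u v) (l₀ * ‖h - h'‖ * max ‖u‖ c))
    (hm : ∀ h h' : E 0, ‖h‖ ≤ ρ → ‖h'‖ ≤ ρ → Q 0 (y₀ h - y₀ h') (m₀ * ‖h - h'‖))
    (hsmall : max m₀ (max (l₀ * ε / η) ((α * b₀ + a₀ * (η + β + 2 * ρ * b₀)) * ε))
      ≤ (1 - κ) / 2) :
    ∃ h : E 0, ‖h‖ ≤ ρ ∧ ∃ x : ∀ k, E k,
      IsTunedQ N (A h) (B h) (S h) (y₀ h) x ∧ InTubeQ N η ε Q (S h) (y₀ h) x ∧ x 0 = h := by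
  have hρ : 0 ≤ ρ := hε.trans hερ
  -- the tuned trajectory of system `h`, by the reduced Theorem 12.1
  have hex : ∀ h : E 0, ‖h‖ ≤ ρ → ∃ x : ∀ k, E k,
      IsTunedQ N (A h) (B h) (S h) (y₀ h) x ∧ InTubeQ N η ε Q (S h) (y₀ h) x := by
    intro h hh
    obtain ⟨x, hN, hrel, htube⟩ := exists_tuned_of_normBound hQ.toIsNormBound (hT h hh) hη hη1 hα
      hβ hκ₁ hκ₂ hκ hε hεr (hy₀ h hh) hc₀
    exact ⟨x, ⟨hN, hrel⟩, htube⟩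
  classical
  let Φ : E 0 → E 0 := fun h => if hh : ‖h‖ ≤ ρ then (Classical.choose (hex h hh)) 0 else 0
  have hΦ : ∀ h (hh : ‖h‖ ≤ ρ), Φ h = (Classical.choose (hex h hh)) 0 := fun h hh => by
    simp only [Φ, dif_pos hh]
  have hmaps : ∀ h, ‖h‖ ≤ ρ → ‖Φ h‖ ≤ ρ := by
    intro h hh
    rw [hΦ h hh]
    obtain ⟨-, htu⟩ := Classical.choose_spec (hex h hh)
    have := (htu 0 (Nat.zero_le _)).1
    rw [pow_zero, mul_one] at this
    exact this.trans hερ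
  have hlip : ∀ h h', ‖h‖ ≤ ρ → ‖h'‖ ≤ ρ → ‖Φ h - Φ h'‖ ≤ (1 / 2) * ‖h - h'‖ := by
    intro h h' hh hh'
    rw [hΦ h hh, hΦ h' hh']
    obtain ⟨htr, htu⟩ := Classical.choose_spec (hex h hh)
    obtain ⟨htr', htu'⟩ := Classical.choose_spec (hex h' hh')
    set t := ‖h - h'‖ with ht
    have ht0 : 0 ≤ t := norm_nonneg _
    have ht2 : t ≤ 2 * ρ := by
      calc t ≤ ‖h‖ + ‖h'‖ := norm_sub_le _ _
        _ ≤ ρ + ρ := add_le_add hh hh'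
        _ = 2 * ρ := by ring
    have hd := norm_sub_le_of_isTunedQ (a := a₀ * t) (b := b₀ * t) (l := l₀ * t) (m := m₀ * t)
      hQ (hT h hh) hη hη1 hα hβ hκ₁ hκ₂ hκ hε hεr htr htr' htu htu'
      (mul_nonneg ha0 ht0) (mul_nonneg hl0 ht0)
      (fun k hk w => ha h h' hh hh' k hk w) (fun k hk v c hv => hb h h' hh hh' k hk v c hv)
      (fun k hk u v c hu hv hc => hl h h' hh hh' k hk u v c hu hv hc) (hm h h' hh hh')
    have h0 := hd 0 (Nat.zero_le _)
    rw [pow_zero, mul_one] at h0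
    refine h0.trans ?_
    have hP : pertSize α β η ε (a₀ * t) (b₀ * t) (l₀ * t) (m₀ * t) ≤
        t * max m₀ (max (l₀ * ε / η) ((α * b₀ + a₀ * (η + β + 2 * ρ * b₀)) * ε)) := by
      unfold pertSize
      have e1 : m₀ * t = t * m₀ := mul_comm _ _
      have e2 : l₀ * t * ε / η = t * (l₀ * ε / η) := by ring
      have e3 : (α * (b₀ * t) + a₀ * t * (η + β + b₀ * t)) * ε =
          t * ((α * b₀ + a₀ * (η + β + b₀ * t)) * ε) := by ring
      rw [e1, e2, e3, ← mul_max_of_nonneg _ _ ht0, ← mul_max_of_nonneg _ _ ht0]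
      refine mul_le_mul_of_nonneg_left (max_le_max le_rfl (max_le_max le_rfl ?_)) ht0
      refine mul_le_mul_of_nonneg_right (add_le_add le_rfl ?_) hε
      refine mul_le_mul_of_nonneg_left (add_le_add le_rfl ?_) ha0
      calc b₀ * t ≤ b₀ * (2 * ρ) := mul_le_mul_of_nonneg_left ht2 hb0
        _ = 2 * ρ * b₀ := by ring
    have h1κ : 0 < 1 - κ := by linarith
    calc pertSize α β η ε (a₀ * t) (b₀ * t) (l₀ * t) (m₀ * t) / (1 - κ)
        ≤ t * max m₀ (max (l₀ * ε / η) ((α * b₀ + a₀ * (η + β + 2 * ρ * b₀)) * ε)) / (1 - κ) :=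
          div_le_div_of_nonneg_right hP h1κ.le
      _ ≤ t * ((1 - κ) / 2) / (1 - κ) :=
          div_le_div_of_nonneg_right (mul_le_mul_of_nonneg_left hsmall ht0) h1κ.le
      _ = 1 / 2 * t := by field_simp
  obtain ⟨h, hh, hfix, -, -⟩ :=
    exists_fixedPt_of_lipschitz_of_norm_le (T := Φ) (κ := 1 / 2) (by norm_num) (by norm_num)
      hρ hlip hmaps
  refine ⟨h, hh, Classical.choose (hex h hh), (Classical.choose_spec (hex h hh)).1,
    (Classical.choose_spec (hex h hh)).2, ?_⟩
  rw [← hΦ h hh]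
  exact hfix

end secondFixedPoint

end RGFlow

end Literature.Dynamics.Hyperbolic

end
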